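import Summits.PneNP.PneNP.Theses.ProofCplx
import Literature.Computability.MetaComplexity.ProofSystemsProofs

/-!
# Route ProofCplx — `ProofcplxGeneratorImpliesNPNeCoNP` (item `stmt-PneNP-0114`)

Krajíček's remark (arXiv:2208.11642, §1, p. 4; *Proof complexity* (2019), Lemma 19.4.1): if a
polynomial-time function `g : {0,1}* → {0,1}*` stretches every input by exactly one bit and its
range meets every infinite `NP` language, then `NP ≠ coNP`.

Proof (elementary, kernel-checked here with no named fact left as a hypothesis):

* `range g ∈ NP`: `g` is a Cook–Reckhow proof system for its own range
  (`IsCookReckhowFunctionFor.isProofSystemFor`, the graph verifier `V x π := [g π = x]`), and it is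
  polynomially bounded because a proof `π` of `x = g π` has length `|x| - 1`; so Cook–Reckhow's
  Prop. 1.4 in the general form `HasPolyBoundedProofSystem L ↔ L ∈ NP`
  (`hasPolyBoundedProofSystem_iff_mem_NP_holds`) puts `range g` in `NP`;
* `(range g)ᶜ` is infinite: for every `n` some string of length `n + 1` is outside the range
  (pigeonhole: the `2^(n+1)` strings of length `n + 1` cannot all be images of the `2^n` strings of
  length `n`);
* if `NP = coNP` then `(range g)ᶜ ∈ coNP = NP` is an infinite `NP` language missed by the range
  of `g`, contradicting the hitting hypothesis.

Prover prover-PneNP-route-PneNP-ExpanderLinearGenerators-3, 2026-08-16 (the item is the support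
rung `crux #2 → NP ≠ coNP` of route ProofCplx; its target X = `stmt-PneNP-0097` is shared with
route ExpanderLinearGenerators).
-/

set_option linter.dupNamespace false -- `Summit.PneNP.PneNP.…`: summit = sub-problem name (D-0017 single-conjunct layout)

namespace Summit.PneNP.PneNP.Theorems

open Literature.Computability.Complexity Literature.Computability.MetaComplexity

/-- **Pigeonhole for a one-bit-stretching map.** If `|g x| = |x| + 1` for all `x`, then for every
`n` some string of length `n + 1` is not in the range of `g` (there are `2^(n+1)` strings of
length `n + 1` but only `2^n` possible preimages, all of length `n`). [folklore] -/
theorem exists_length_succ_not_mem_range {g : List Bool → List Bool}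
    (hlen : ∀ x, (g x).length = x.length + 1) (n : ℕ) :
    ∃ y : List Bool, y.length = n + 1 ∧ y ∉ Set.range g := by
  by_contra h
  push Not at h
  -- every string of length `n + 1` has a (necessarily length-`n`) preimage
  have hpre : ∀ f : Fin (n + 1) → Bool, ∃ x : List Bool, x.length = n ∧ g x = List.ofFn f := by
    intro f
    obtain ⟨x, hx⟩ := h (List.ofFn f) (List.length_ofFn (f := f))
    refine ⟨x, ?_, hx⟩
    have := hlen x
    rw [hx, List.length_ofFn] at this
    omega
  choose pre hpre_len hpre_eq using hpre
  -- read a length-`n` preimage as a function `Fin n → Bool`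
  let φ : (Fin (n + 1) → Bool) → (Fin n → Bool) :=
    fun f i => (pre f).get (Fin.cast (hpre_len f).symm i)
  have hφ : Function.Injective φ := by
    intro f₁ f₂ hf
    have hx : pre f₁ = pre f₂ := by
      apply List.ext_get (by rw [hpre_len, hpre_len])
      intro i h₁ h₂
      have := congrFun hf ⟨i, by rw [hpre_len] at h₁; exact h₁⟩
      simpa [φ, Fin.cast] using this
    have hg : List.ofFn f₁ = List.ofFn f₂ := by rw [← hpre_eq f₁, ← hpre_eq f₂, hx]
    exact List.ofFn_injective hg
  have hcard := Fintype.card_le_of_injective φ hφ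
  simp only [Fintype.card_fun, Fintype.card_bool, Fintype.card_fin] at hcard
  have : 2 ^ n < 2 ^ (n + 1) := Nat.pow_lt_pow_right (by norm_num) (by omega)
  omega

/-- The complement of the range of a one-bit-stretching map is infinite (it contains a string of
every positive length). [folklore] -/
theorem compl_range_infinite_of_stretching {g : List Bool → List Bool}
    (hlen : ∀ x, (g x).length = x.length + 1) : (Set.range g)ᶜ.Infinite := by
  intro hfin
  obtain ⟨N, hN⟩ := (hfin.image List.length).bddAbove
  obtain ⟨y, hy, hyR⟩ := exists_length_succ_not_mem_range hlen N
  have : y.length ≤ N := hN ⟨y, hyR, rfl⟩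
  omega

/-- **The range of a polynomial-time one-bit-stretching map is in `NP`.** The graph verifier
`V x π := [g π = x]` is a Cook–Reckhow proof system for `range g`
(`IsCookReckhowFunctionFor.isProofSystemFor`), polynomially bounded with the polynomial `X`
(a proof of `x` has length `|x| - 1`), so `range g ∈ NP` by Cook–Reckhow's Prop. 1.4 in the
general form `HasPolyBoundedProofSystem L ↔ L ∈ NP`. [cite: CookReckhow1979, §1 Prop. 1.4] -/
theorem range_mem_NP_of_stretching {g : List Bool → List Bool} (hg : g ∈ FP)
    (hlen : ∀ x, (g x).length = x.length + 1) :
    (Set.range g : Language Bool) ∈ Nondeterministic.NP := by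
  have hCR : IsCookReckhowFunctionFor g (Set.range g : Language Bool) := ⟨hg, rfl⟩
  have hV := hCR.isProofSystemFor
  have hPB : IsPolyBounded fun x π => decide (g π = x) := by
    refine ⟨Polynomial.X, fun x π hπ => ⟨π, ?_, hπ⟩⟩
    have hgx : g π = x := of_decide_eq_true hπ
    have := hlen π
    rw [hgx] at this
    simp only [Polynomial.eval_X]
    omega
  exact hasPolyBoundedProofSystem_iff_mem_NP_holds.1
    (HasPolyBoundedProofSystem.of_isPolyBounded hV hPB)

/-- **Krajíček's remark, general form**: a polynomial-time map stretching each input by one bit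
whose range meets every infinite `NP` language forces `NP ≠ coNP` — otherwise the complement of
its range would be an infinite `NP` language (it is in `coNP` and infinite by counting) disjoint
from the range. [cite: Krajicek2022, §1 (p. 4)] -/
theorem NP_ne_coNP_of_stretching_generator {g : List Bool → List Bool} (hg : g ∈ FP)
    (hlen : ∀ x, (g x).length = x.length + 1)
    (hhit : ∀ L ∈ Nondeterministic.NP, L.Infinite → ∃ x, g x ∈ L) :
    Nondeterministic.NP ≠ coNP := by
  intro heq
  have hR : (Set.range g : Language Bool) ∈ Nondeterministic.NP := range_mem_NP_of_stretching hg hlen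
  -- the complement of the range is in `coNP = NP`
  have hRc : ((Set.range g)ᶜ : Language Bool) ∈ Nondeterministic.NP := by
    rw [heq]
    show ((Set.range g : Language Bool)ᶜ)ᶜ ∈ Nondeterministic.NP
    rw [compl_compl]
    exact hR
  obtain ⟨x, hx⟩ := hhit _ hRc (compl_range_infinite_of_stretching hlen)
  exact hx ⟨x, rfl⟩

/-- **Item `stmt-PneNP-0114`** (`ProofcplxGeneratorImpliesNPNeCoNP`, support rung of route
ProofCplx): Krajíček's generator conjecture (crux #2, `ProofcplxKrajicekGenerator`) implies
`NP ≠ coNP`. [cite: Krajicek2022, §1 (p. 4)] -/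
theorem proofcplx_generatorImpliesNPNeCoNP_proof :
    Summit.PneNP.PneNP.Theses.ProofCplx.ProofcplxGeneratorImpliesNPNeCoNP := by
  unfold Summit.PneNP.PneNP.Theses.ProofCplx.ProofcplxGeneratorImpliesNPNeCoNP
  rintro ⟨g, hg, hlen, hhit⟩
  exact NP_ne_coNP_of_stretching_generator hg hlen hhit

end Summit.PneNP.PneNP.Theorems
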